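import Mathlib
import Summits.NavierStokesRegularity.NavierStokesRegularity.Theorems.FilamentSkeletonRssAreaLawSlavingLocalUnique

/-!
# Area-law slaving, part 12 — LOCAL uniqueness along an arm (interval hypotheses)
# (`FilamentSkeletonRss`, child crux `TangentSkeletonNearStraight`, stmt-NavierStokesRegularity-28295, line
# `child_tangent_analytic_strip`, ∃-side of the registered stub `stub_analyticClosing`: the `StadiumAnalyticArea` conjunct)

Interval form of `Theorems.AreaLawSlaving.areaLaw_unique_arm_right` (part 6 §2), companion of part 11
(`areaLaw_unique_window_right_local`): if two solutions of the area law `w·A′ = (3/2 − w′)·A + 4` agree at `s₀` and the slip is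
bounded below by `wmin > 0` on `[s₀, s₁]`, they agree on `[s₀, s₁]` — with differentiability and the equations assumed on `[s₀, s₁]`
only (`E²·e^{−3τ/wmin}` is antitone there, `E = w(A₁ − A₂)`).  Together with part 11 this identifies, on the real trace of the
stadium to the right of the zero, the continued core area (`Theorems.AreaLawSlavingHolo.areaLaw_holo`) with the slaved area.

HONEST FRAMING: elementary ODE analysis serving a HYPOTHETICAL filament skeleton on the NEGATIVE side of a MODEL route; no registered
stub is closed by this file and nothing here bears on Navier–Stokes regularity or blow-up.  `--supports stmt-NavierStokesRegularity-28295`.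
-/

set_option linter.dupNamespace false

noncomputable section

namespace Summit.NavierStokesRegularity.NavierStokesRegularity.Theorems.AreaLawSlaving

open Set Real

/-- **Local propagation along the (right) arm.**  On `[s₀, s₁]`: `w, A₁, A₂` differentiable, both area laws hold, `w ≥ wmin > 0`;
if `A₁ s₀ = A₂ s₀` then `A₁ = A₂` on `[s₀, s₁]`. [folklore] -/
theorem areaLaw_unique_arm_right_local {w A₁ A₂ : ℝ → ℝ} {s₀ s₁ wmin : ℝ}
    (hw : ∀ s ∈ Icc s₀ s₁, DifferentiableAt ℝ w s) (hA₁ : ∀ s ∈ Icc s₀ s₁, DifferentiableAt ℝ A₁ s)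
    (hA₂ : ∀ s ∈ Icc s₀ s₁, DifferentiableAt ℝ A₂ s)
    (h₁ : ∀ s ∈ Icc s₀ s₁, w s * deriv A₁ s = (3 / 2 - deriv w s) * A₁ s + 4)
    (h₂ : ∀ s ∈ Icc s₀ s₁, w s * deriv A₂ s = (3 / 2 - deriv w s) * A₂ s + 4) (hwmin : 0 < wmin)
    (hws : ∀ s ∈ Icc s₀ s₁, wmin ≤ w s) (h0 : A₁ s₀ = A₂ s₀) {τ : ℝ} (hτ : s₀ ≤ τ) (hτ₁ : τ ≤ s₁) : A₁ τ = A₂ τ := by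
  set D : ℝ → ℝ := fun s => A₁ s - A₂ s with hD
  have hE : ∀ s ∈ Icc s₀ s₁, HasDerivAt (fun s => w s * D s) (3 / 2 * D s) s := fun s hs =>
    areaLaw_diff_hasDerivAt_at (hw s hs) (hA₁ s hs) (hA₂ s hs) (h₁ s hs) (h₂ s hs)
  have hΦd : ∀ s ∈ Icc s₀ s₁, HasDerivAt (fun s => (w s * D s) ^ 2 * Real.exp (-(3 / wmin) * s))
      (2 * (w s * D s) * (3 / 2 * D s) * Real.exp (-(3 / wmin) * s) +
        (w s * D s) ^ 2 * (Real.exp (-(3 / wmin) * s) * (-(3 / wmin)))) s := by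
    intro s hs
    have hn : HasDerivAt (fun s => (w s * D s) ^ 2) (2 * (w s * D s) * (3 / 2 * D s)) s := by
      have := (hE s hs).fun_pow 2
      exact this.congr_deriv (by ring)
    have he : HasDerivAt (fun s => Real.exp (-(3 / wmin) * s)) (Real.exp (-(3 / wmin) * s) * (-(3 / wmin))) s := by
      have := ((hasDerivAt_id' s).const_mul (-(3 / wmin))).exp
      simpa using this
    exact hn.mul he
  have hanti : AntitoneOn (fun s => (w s * D s) ^ 2 * Real.exp (-(3 / wmin) * s)) (Icc s₀ s₁) := by
    apply antitoneOn_of_deriv_nonpos (convex_Icc s₀ s₁)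
    · exact HasDerivAt.continuousOn fun s hs => hΦd s hs
    · intro s hs
      rw [interior_Icc] at hs
      exact (hΦd s ⟨hs.1.le, hs.2.le⟩).differentiableAt.differentiableWithinAt
    · intro s hs
      rw [interior_Icc] at hs
      rw [(hΦd s ⟨hs.1.le, hs.2.le⟩).deriv]
      have hwle : wmin ≤ w s := hws s ⟨hs.1.le, hs.2.le⟩
      have hwpos : 0 < w s := hwmin.trans_le hwle
      have hnum : 2 * (w s * D s) * (3 / 2 * D s) * Real.exp (-(3 / wmin) * s) +
          (w s * D s) ^ 2 * (Real.exp (-(3 / wmin) * s) * -(3 / wmin)) =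
          3 * Real.exp (-(3 / wmin) * s) * (w s * D s ^ 2) * (1 - w s / wmin) := by
        field_simp
        ring
      rw [hnum]
      have h1 : 0 ≤ 3 * Real.exp (-(3 / wmin) * s) * (w s * D s ^ 2) := by positivity
      have h2 : 1 - w s / wmin ≤ 0 := by rw [sub_nonpos, le_div_iff₀ hwmin, one_mul]; exact hwle
      exact mul_nonpos_of_nonneg_of_nonpos h1 h2
  have hs₀I : s₀ ∈ Icc s₀ s₁ := ⟨le_rfl, hτ.trans hτ₁⟩
  have h := hanti hs₀I ⟨hτ, hτ₁⟩ hτ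
  simp only at h
  have hD0 : D s₀ = 0 := by rw [hD]; simp only; rw [h0, sub_self]
  rw [hD0, mul_zero] at h
  simp only [ne_eq, OfNat.ofNat_ne_zero, not_false_eq_true, zero_pow, zero_mul] at h
  have hexp : 0 < Real.exp (-(3 / wmin) * τ) := Real.exp_pos _
  have hsq : (w τ * D τ) ^ 2 ≤ 0 := by
    rcases mul_nonpos_iff.1 h with ⟨_, h2⟩ | ⟨h1, _⟩
    · exact absurd h2 (not_le.2 hexp)
    · exact h1
  have hzero : w τ * D τ = 0 := by
    have := le_antisymm hsq (sq_nonneg _)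
    exact pow_eq_zero_iff (n := 2) (by norm_num) |>.1 this
  have hwτ : 0 < w τ := hwmin.trans_le (hws τ ⟨hτ, hτ₁⟩)
  rcases mul_eq_zero.1 hzero with h | h
  · exact absurd h hwτ.ne'
  · have : A₁ τ - A₂ τ = 0 := h
    linarith

end Summit.NavierStokesRegularity.NavierStokesRegularity.Theorems.AreaLawSlaving
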